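import Mathlib.Analysis.SpecialFunctions.Pow.Real
import HarnessLib

/-!
# K2R `RealisedQuasiStaticCellLaw`, line `floquet-bloch`, stub `stub_lowSectorDecay` (S1D): the finite-`n` defect of the
# in-plane slaving weight (pure real arithmetic)

Summits-side helper file (everything proved; no definitions, no named facts; `--supports stmt-AnomalousDissipation-20446`).
With `a = |ℓ|`, `b = |K|`, `C = |ℓ·K| ≤ ab`, `4a ≤ b`, the floor of `inPlane_weight_lower` is within `12·a/b` of the
nominal in-plane weight `2ĉ²`, `ĉ = C/(ab) = |ℓ̂·K̂|`:
`2ĉ² − 12a/b ≤ 2·max((C − a²)/(a(a+b)), 0)²/(1 + 2C/b²)` (`inPlane_floor_defect`). This is the only place where the W-near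
isotropy loses `O(|ℓ|/n)`; with `b = n|m_j| ≥ K/ν` it is absorbed in `δ`.
-/

set_option linter.dupNamespace false

noncomputable section

namespace Summit.AnomalousDissipation.AnomalousDissipation.Theorems.SolenoidalFractalHomogenisation.RealisedQuasiStaticCellLaw

/-- **Finite-`n` defect of the in-plane floor.** -/
theorem inPlane_floor_defect {a b C : ℝ} (ha : 0 < a) (hb : 0 < b) (hC0 : 0 ≤ C) (hCab : C ≤ a * b)
    (h4 : 4 * a ≤ b) :
    2 * (C / (a * b)) ^ 2 - 12 * (a / b) ≤ 2 * (max ((C - a ^ 2) / (a * (a + b))) 0) ^ 2 / (1 + 2 * C / b ^ 2) := by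
  obtain ⟨c, hc⟩ : ∃ c : ℝ, c = C / (a * b) := ⟨_, rfl⟩
  obtain ⟨r, hr⟩ : ∃ r : ℝ, r = a / b := ⟨_, rfl⟩
  have hab : 0 < a * b := mul_pos ha hb
  have hc0 : 0 ≤ c := by rw [hc]; positivity
  have hc1 : c ≤ 1 := by rw [hc, div_le_one hab]; exact hCab
  have hr0 : 0 < r := by rw [hr]; positivity
  have hr4 : r ≤ 1 / 4 := by rw [hr, div_le_iff₀ hb]; linarith
  have hCe : C = c * (a * b) := by rw [hc]; field_simp
  have hae : a = r * b := by rw [hr]; field_simp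
  -- rewrite everything in terms of `c, r, b`
  have hF : (C - a ^ 2) / (a * (a + b)) = (c - r) / (r + 1) := by
    rw [hCe, hae]; field_simp
  have hD : 1 + 2 * C / b ^ 2 = 1 + 2 * c * r := by
    rw [hCe, hae]; field_simp
  rw [← hc, ← hr, hF, hD]
  have hD0 : 0 < 1 + 2 * c * r := by nlinarith
  -- the floor dominates `c − 2r`
  have hFge : c - 2 * r ≤ (c - r) / (r + 1) := by
    rw [le_div_iff₀ (by linarith)]; nlinarith
  by_cases hcr : c - 2 * r ≤ 0
  · -- trivial case: the left side is negative
    have hL : 2 * c ^ 2 - 12 * r ≤ 0 := by nlinarith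
    exact hL.trans (div_nonneg (mul_nonneg (by norm_num) (sq_nonneg _)) hD0.le)
  · push Not at hcr
    have hM : c - 2 * r ≤ max ((c - r) / (r + 1)) 0 := hFge.trans (le_max_left _ _)
    have hM0 : 0 ≤ max ((c - r) / (r + 1)) 0 := le_max_right _ _
    have hsq : (c - 2 * r) ^ 2 ≤ (max ((c - r) / (r + 1)) 0) ^ 2 := pow_le_pow_left₀ hcr.le hM 2
    rw [le_div_iff₀ hD0]
    -- (2c² − 12r)(1 + 2cr) ≤ 2(c − 2r)² ≤ 2 max²
    have hc3 : c ^ 3 ≤ 1 := pow_le_one₀ hc0 hc1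
    have hpos : 0 ≤ r * (12 - 8 * c + 8 * r + 24 * c * r - 4 * c ^ 3) :=
      mul_nonneg hr0.le (by nlinarith [mul_nonneg hc0 hr0.le])
    have e : 2 * (c - 2 * r) ^ 2 - (2 * c ^ 2 - 12 * r) * (1 + 2 * c * r) =
        r * (12 - 8 * c + 8 * r + 24 * c * r - 4 * c ^ 3) := by ring
    linarith [hsq, hpos, e]

end Summit.AnomalousDissipation.AnomalousDissipation.Theorems.SolenoidalFractalHomogenisation.RealisedQuasiStaticCellLaw

end
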